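import Mathlib.MeasureTheory.Measure.MeasureSpace
import Literature.Probability.RandomPlanarGeometry.SimpleCurves
import Literature.Probability.RandomPlanarGeometry.ConformalRestrictionProofs
import Literature.Probability.RandomPlanarGeometry.CritPercSLESimplePathHolds
import Literature.Probability.RandomPlanarGeometry.CaratheodoryHalfPlaneProofs

/-!
# Curve upgrade, part 3a: moduli of simple arcs, the SLE(8/3) law is carried by simple arcs from
`a` to `b`, and an exhaustion lemma

Support file for the crux `HexConjecture` (stmt-CriticalPhenomena-0808, Duminil-Copin–Smirnov 2012
Conjecture 1), line `root-locality-replaces-loewner`, stub `stub_curveUpgrade` (ABSTRACT upgrade of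
range convergence to curve convergence in `CurveClass ℂ`). Namespace `…RootLocality.Upgrade`.
Ingredients of the identification step (PART 3):

* `exists_osc_modulus`, `exists_sep_modulus`, `exists_inj_modulus` — every curve has a continuity
  modulus at every scale; an injective curve has, at every parameter scale `h > 0`, a separation
  `d > 0` (`|u - v| ≥ h ⟹ dist (η u) (η v) ≥ d`, compactness) and hence an injectivity modulus
  (`dist (η u) (η v) ≤ d ⟹ |u - v| ≤ τ`) — the four moduli hypotheses of the deterministic lemma
  `dist_le_or_tripleStrand` (part 1c) are therefore available for every simple arc, at all scales;
* `exists_measure_le_add_of_subset_iUnion` — exhaustion: if `B ⊆ N ∪ ⋃ₖ A k` with `A` increasing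
  and `μ N = 0` (`μ` finite), then `μ B ≤ μ (A k) + θ` for some `k` (continuity from below of the
  outer measure, `tendsto_measure_iUnion_atTop`; no measurability needed);
* `ae_exists_simple_rep` (registered helper) — the law of a chordal SLE_κ curve `Γ` in `(D; a, b)`,
  `0 < κ ≤ 4`, is carried by the classes of INJECTIVE curves `η` with `η 0 = a`, `η 1 = b`
  (Rohde–Schramm Thm. 6.1 via the tree's `IsSLELaw.ae_simple` with the discharged facts
  `ae_isSimpleTrace_sleTrace_of_le_four_holds`, `CurveClass.measurableSet_simple_holds`, and the
  endpoints `IsSLELaw.ae_endpoints` with `JordanDomain.mapsTo_boundaryExtension_holds`).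

Folklore apart from the cited tree theorems; no undischarged named fact is used.
-/

noncomputable section

open MeasureTheory Filter Topology Set Metric
open scoped ENNReal NNReal unitInterval

namespace Summit.CriticalPhenomena.SAWScalingLimit.Theorems.HexConjecture.RootLocality.Upgrade

open Literature.Probability.RandomPlanarGeometry

/-! ### Moduli of curves and of simple arcs -/

section Moduli

variable {E : Type*} [PseudoMetricSpace E]

/-- Continuity modulus of a curve at scale `r > 0`: some `h > 0` with
`dist u v ≤ h ⟹ dist (η u) (η v) ≤ r` (uniform continuity on the compact interval). [folklore] -/
theorem exists_osc_modulus (η : Curve E) {r : ℝ} (hr : 0 < r) :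
    ∃ h : ℝ, 0 < h ∧ ∀ u v : I, dist u v ≤ h → dist (η u) (η v) ≤ r := by
  obtain ⟨θ, hθ, hη⟩ := Metric.uniformContinuous_iff.1
    (CompactSpace.uniformContinuous_of_continuous η.continuous) r hr
  exact ⟨θ / 2, half_pos hθ, fun u v huv ↦ (hη (huv.trans_lt (half_lt_self hθ))).le⟩

end Moduli

section Simple

variable {E : Type*} [MetricSpace E]

/-- Separation of a simple arc at parameter scale `h > 0`: some `d > 0` with
`h ≤ dist u v ⟹ d ≤ dist (η u) (η v)` (the continuous positive function `dist (η u) (η v)` on the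
compact set `{h ≤ dist u v}` is bounded below). [folklore] -/
theorem exists_sep_modulus {η : Curve E} (hη : η.IsSimple) {h : ℝ} (hh : 0 < h) :
    ∃ d : ℝ, 0 < d ∧ ∀ u v : I, h ≤ dist u v → d ≤ dist (η u) (η v) := by
  set K : Set (I × I) := {p | h ≤ dist p.1 p.2} with hK
  have hKc : IsCompact K := (isClosed_le continuous_const continuous_dist).isCompact
  have hcont : ContinuousOn (fun p : I × I ↦ dist (η p.1) (η p.2)) K := by
    have hη' := η.continuous
    exact Continuous.continuousOn (by fun_prop)
  have hposK : ∀ p ∈ K, (0 : ℝ) < dist (η p.1) (η p.2) := by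
    intro p hp
    refine dist_pos.2 fun heq ↦ ?_
    have hp' : h ≤ dist p.1 p.2 := hp
    rw [hη heq, dist_self] at hp'
    exact absurd hp' (not_le.2 hh)
  obtain ⟨d, hd, hdK⟩ := hKc.exists_forall_le' hcont hposK
  exact ⟨d, hd, fun u v huv ↦ hdK (u, v) huv⟩

/-- Injectivity modulus of a simple arc at scale `τ > 0`: some `d > 0` with
`dist (η u) (η v) ≤ d ⟹ dist u v ≤ τ`. [folklore] -/
theorem exists_inj_modulus {η : Curve E} (hη : η.IsSimple) {τ : ℝ} (hτ : 0 < τ) :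
    ∃ d : ℝ, 0 < d ∧ ∀ u v : I, dist (η u) (η v) ≤ d → dist u v ≤ τ := by
  obtain ⟨d, hd, hsep⟩ := exists_sep_modulus hη hτ
  refine ⟨d / 2, half_pos hd, fun u v huv ↦ ?_⟩
  by_contra hlt
  have := hsep u v (not_le.1 hlt).le
  linarith

end Simple

/-! ### Exhaustion up to a null set -/

/-- **Exhaustion**: if `B ⊆ N ∪ ⋃ₖ A k` with `A` increasing, `μ N = 0`, `μ` finite and `θ > 0`,
then `μ B ≤ μ (A k) + θ` for some `k` (continuity of the outer measure from below along the
increasing sequence; the sets need not be measurable). [folklore] -/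
theorem exists_measure_le_add_of_subset_iUnion {α : Type*} {m : MeasurableSpace α}
    (μ : Measure α) [IsFiniteMeasure μ] {B N : Set α} {A : ℕ → Set α} (hmono : Monotone A)
    (hN : μ N = 0) (hcov : B ⊆ N ∪ ⋃ k, A k) {θ : ℝ≥0∞} (hθ : 0 < θ) :
    ∃ k, μ B ≤ μ (A k) + θ := by
  set L := μ (⋃ k, A k) with hL
  have hBL : μ B ≤ L :=
    calc μ B ≤ μ (N ∪ ⋃ k, A k) := measure_mono hcov
      _ ≤ μ N + μ (⋃ k, A k) := measure_union_le _ _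
      _ = L := by rw [hN, zero_add]
  rcases eq_or_ne L 0 with hL0 | hL0
  · exact ⟨0, by rw [hL0] at hBL; exact hBL.trans bot_le⟩
  have hlim : Tendsto (μ ∘ A) atTop (𝓝 L) := tendsto_measure_iUnion_atTop hmono
  have hlt : L - θ < L := ENNReal.sub_lt_self (measure_ne_top _ _) hL0 hθ.ne'
  obtain ⟨k, hk⟩ := (hlim.eventually_const_lt hlt).exists
  exact ⟨k, hBL.trans (le_tsub_add.trans (add_le_add hk.le le_rfl))⟩

/-! ### The SLE law is carried by simple arcs between the marked points -/

/-- **The SLE_κ law (`0 < κ ≤ 4`) is carried by simple arcs from `a` to `b`** (registered helper of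
`stub_curveUpgrade`, used at `κ = 8/3`): for the law of a chordal SLE_κ curve `Γ` of the Dobrushin
domain `(D; a, b)`, almost every class has an INJECTIVE representative `η` with `η 0 = D.pt 0`,
`η 1 = D.pt 1` (Rohde–Schramm 2005 Thm. 6.1, `IsSLELaw.ae_simple` with the discharged
`ae_isSimpleTrace_sleTrace_of_le_four_holds`; endpoints `IsSLELaw.ae_endpoints` with
`JordanDomain.mapsTo_boundaryExtension_holds`). [folklore] -/
theorem ae_exists_simple_rep : ∀ (κ : NNReal) (D : Literature.Probability.RandomPlanarGeometry.DobrushinDomain) (Γ : (NNReal → ℝ) → Literature.Probability.RandomPlanarGeometry.CurveClass ℂ), 0 < κ → κ ≤ 4 → Literature.Probability.RandomPlanarGeometry.IsSLECurve κ D Γ → ∀ᵐ γ ∂(Literature.Probability.Process.preWienerMeasure.map Γ), ∃ η : Literature.Probability.RandomPlanarGeometry.Curve ℂ, Literature.Probability.RandomPlanarGeometry.CurveClass.mk η = γ ∧ η.IsSimple ∧ η 0 = D.pt 0 ∧ η 1 = D.pt 1 := by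
  intro κ D Γ h0 h4 hΓ
  have hlaw : IsSLELaw κ D (Literature.Probability.Process.preWienerMeasure.map Γ) :=
    hΓ.isSLELaw_map
  filter_upwards [IsSLELaw.ae_simple ae_isSimpleTrace_sleTrace_of_le_four_holds
    CurveClass.measurableSet_simple_holds h0 h4 hlaw,
    hlaw.ae_endpoints JordanDomain.mapsTo_boundaryExtension_holds] with γ hs he
  obtain ⟨η, hη, rfl⟩ := hs.1
  exact ⟨η, rfl, hη, he.1, he.2.1⟩

end Summit.CriticalPhenomena.SAWScalingLimit.Theorems.HexConjecture.RootLocality.Upgrade
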